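import Summits.Ventures.DiscreteObjects.PP12.FlagSevenColOrbits
import Summits.Ventures.DiscreteObjects.PP12.FlagSevenRowOrbits

/-!
# The `f = 7` flag-cell orbit matrix: the entries as incidence counts, I — rows `Γ_s` and T-line rows (kernel; Step C₂ of the FlagSevenOrbitReduction roadmap)
Framing: lottery ticket; floor = certified bounds/negative ranges.

Cell pub-namedobj (venture DiscreteObjects), target (M), designs gen 14. Setting as in `FlagSevenOrbitDataOfPlane` / `FlagSevenColOrbits`. The typed
statement `IsFlagSevenOrbitMatrix` (p327216) defines `entry r c` by formulas in the data; here they are identified with the INCIDENCE COUNTS of the plane,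
`entry r c = |colOrbit c ∩ lineRep r|` (`lineRep r` the representative line of the row orbit, `FlagSevenRowOrbits`), for the rows `Γ_s`
(c-line orbits) and `(k,t)` (T-line orbits) against all three column types (`entry_eq_cline_*`, `entry_eq_tline_*`); the side rows are in part II
(`FlagSevenEntriesB`). Tools (`FlagSevenRowOrbits`): `card_filter_orb3_on_fixedLine` (a line `a ≠ m` meets an orbit of points of the fixed line `m`
in `[a ∩ m ∈ orbit]` points), `not_mem_orb3_of_fixed`, `triIdx_class_unique`. No `sorry`, no new axioms.
-/

namespace Summit.Ventures.DiscreteObjects.PP12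

open Configuration Finset
open scoped Classical

namespace Collineation

variable {P L : Type*} [Membership P L] [ProjectivePlane P L] [Fintype P] [Fintype L] (σ : Collineation P L)

section Flag

variable {l : L} {c : P} (hl : σ.onLines l = l) (hc : σ.onPoints c = c) (hcl : c ∈ l)
  (hP : ∀ p : P, σ.onPoints p = p → p ∈ l) (hL : ∀ m : L, σ.onLines m = m → c ∈ m)
  (h12 : ProjectivePlane.order P L = 12)

section Data

variable (hl : σ.onLines l = l) (hc : σ.onPoints c = c) (hcl : c ∈ l)
  (hP : ∀ p : P, σ.onPoints p = p → p ∈ l) (hL : ∀ m : L, σ.onLines m = m → c ∈ m) (h12 : ProjectivePlane.order P L = 12)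
  (hq : σ.onPoints ^ 3 = 1) (hf : fixedCard σ.onPoints = 7) {u₀ u₁ : L} (hcu₀ : c ∈ u₀) (hu₀ : σ.onLines u₀ ≠ u₀)
  (hcu₁ : c ∈ u₁) (hu₁ : σ.onLines u₁ ≠ u₁)

/-! ### Rows `Γ_s` -/

/-- `entry (Γ_s) (Z_t) = 0 = |Z_t ∩ cl s|`: the orbits on `l` avoid the c-lines (they meet `l` only in the fixed point `c`). -/
theorem entry_eq_cline_z (s : Fin 2) (t : Fin 2) :
    (σ.flagSevenDataOfPlane hl hc hcl hP hL h12 hq hf hcu₀ hu₀ hcu₁ hu₁).entry (Sum.inl s) (Sum.inl t)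
      = ((σ.colOrbit hl hc hcl hP hL h12 hq hf hcu₀ hu₀ hcu₁ hu₁ (Sum.inl t)).filter
          fun q => q ∈ σ.lineRep hl hc hcl hP hL h12 hq hf hcu₀ hu₀ hcu₁ hu₁ (Sum.inl s)).card := by
  obtain ⟨z, hz, hzeq⟩ := mem_image.1 (σ.eZ hl hP h12 hq hf t).2
  rw [mem_filter] at hz
  have hcs := σ.cl_spec hcu₀ hu₀ hcu₁ hu₁ s
  have hul : cl u₀ u₁ s ≠ l := fun e => hcs.2 (by rw [e, hl])
  have hmeet : meetPt c (cl u₀ u₁ s) l = c := (meetPt_eq c hul hcs.1 hcl).symm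
  change (0 : ℕ) = (((σ.eZ hl hP h12 hq hf t).1 : Finset P).filter fun q => q ∈ cl u₀ u₁ s).card
  rw [← hzeq, σ.card_filter_orb3_on_fixedLine (c := c) hl hul hz.2.1, hmeet, if_neg (σ.not_mem_orb3_of_fixed hc hz.2.2)]

/-- `entry (Γ_s) (triangle (s',i')) = [s' = s]`: a c-line of class `s` carries exactly one vertex of each triangle of class `s` and none of the
other class. -/
theorem entry_eq_cline_tri (h01 : u₁ ∉ orb3 σ.onLines u₀) (s s' : Fin 2) (i' : Fin 12) :
    (σ.flagSevenDataOfPlane hl hc hcl hP hL h12 hq hf hcu₀ hu₀ hcu₁ hu₁).entry (Sum.inl s) (Sum.inr (Sum.inl (s', i')))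
      = ((σ.colOrbit hl hc hcl hP hL h12 hq hf hcu₀ hu₀ hcu₁ hu₁ (Sum.inr (Sum.inl (s', i')))).filter
          fun q => q ∈ σ.lineRep hl hc hcl hP hL h12 hq hf hcu₀ hu₀ hcu₁ hu₁ (Sum.inl s)).card := by
  set x' := σ.eTri7 h12 hcu₀ hu₀ hcu₁ hu₁ s' i' with hx'
  have hcs := σ.cl_spec hcu₀ hu₀ hcu₁ hu₁ s
  change FlagSevenOrbitData.ind (s' = s) = ((orb3 σ.onPoints x'.1).filter fun q => q ∈ cl u₀ u₁ s).card
  unfold FlagSevenOrbitData.ind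
  have hle := σ.card_orb3_inter_cline_le_one hc hq hcs.1 hcs.2 x'.1
  by_cases hss : s' = s
  · subst hss
    rw [if_pos rfl]
    have hpos : 0 < ((orb3 σ.onPoints x'.1).filter fun q => q ∈ cl u₀ u₁ s').card :=
      card_pos.2 ⟨x'.1, mem_filter.2 ⟨self_mem_orb3 _ _, x'.2.1⟩⟩
    omega
  · rw [if_neg hss, eq_comm, card_eq_zero, filter_eq_empty_iff]
    intro p hp hpu
    have hpX := σ.exterior_of_mem_orb3 (σ.exterior_of_triIdx s' x' hcu₀ hu₀ hcu₁ hu₁ hL) hp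
    have hpc : p ≠ c := fun e => hpX l hl (e ▸ hcl)
    exact σ.triIdx_class_unique hc hq hcu₀ hu₀ hcu₁ h01 (fun e => hss e.symm) x' hp hpu hpc

/-- `entry (Γ_s) (T-point orbit (j,t)) = 0`: the orbits on `m_j` meet a c-line only in `c`. -/
theorem entry_eq_cline_tpt (s : Fin 2) (j : Fin 6) (t : Fin 4) :
    (σ.flagSevenDataOfPlane hl hc hcl hP hL h12 hq hf hcu₀ hu₀ hcu₁ hu₁).entry (Sum.inl s) (Sum.inr (Sum.inr (j, t)))
      = ((σ.colOrbit hl hc hcl hP hL h12 hq hf hcu₀ hu₀ hcu₁ hu₁ (Sum.inr (Sum.inr (j, t)))).filter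
          fun q => q ∈ σ.lineRep hl hc hcl hP hL h12 hq hf hcu₀ hu₀ hcu₁ hu₁ (Sum.inl s)).card := by
  set m := σ.eFixL6 hl hc hf j with hm
  obtain ⟨w, hw, hweq⟩ := mem_image.1 (σ.eOrbOn hc hcl hP hL h12 hq m t).2
  rw [mem_filter] at hw
  have hwf : σ.onPoints w ≠ w := fun e => hw.2.2 ((Nondegenerate.eq_or_eq hw.2.1 (hL m.1 m.2.1) (hP w e) hcl).resolve_right m.2.2)
  have hcs := σ.cl_spec hcu₀ hu₀ hcu₁ hu₁ s
  have hum : cl u₀ u₁ s ≠ m.1 := fun e => hcs.2 (by rw [e, m.2.1])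
  have hmeet : meetPt c (cl u₀ u₁ s) m.1 = c := (meetPt_eq c hum hcs.1 (hL m.1 m.2.1)).symm
  change (0 : ℕ) = (((σ.eOrbOn hc hcl hP hL h12 hq m t).1 : Finset P).filter fun q => q ∈ cl u₀ u₁ s).card
  rw [← hweq, σ.card_filter_orb3_on_fixedLine (c := c) m.2.1 hum hw.2.1, hmeet, if_neg (σ.not_mem_orb3_of_fixed hc hwf)]

/-! ### T-line rows `(k,t)` -/

/-- `entry (k,t) (Z_t') = 0`: a T-line meets `l` in the fixed point `y_k`. -/
theorem entry_eq_tline_z (k : Fin 6) (t : Fin 4) (t' : Fin 2) :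
    (σ.flagSevenDataOfPlane hl hc hcl hP hL h12 hq hf hcu₀ hu₀ hcu₁ hu₁).entry (Sum.inr (Sum.inr (k, t))) (Sum.inl t')
      = ((σ.colOrbit hl hc hcl hP hL h12 hq hf hcu₀ hu₀ hcu₁ hu₁ (Sum.inl t')).filter
          fun q => q ∈ σ.lineRep hl hc hcl hP hL h12 hq hf hcu₀ hu₀ hcu₁ hu₁ (Sum.inr (Sum.inr (k, t)))).card := by
  obtain ⟨z, hz, hzeq⟩ := mem_image.1 (σ.eZ hl hP h12 hq hf t').2
  rw [mem_filter] at hz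
  set y := σ.eFixP6 hl hc hf k with hy
  obtain ⟨hyb, hbl, -⟩ := σ.lineRep_tline_spec hl hc hcl hP hL h12 hq hf hcu₀ hu₀ hcu₁ hu₁ k t
  set b := σ.lineRep hl hc hcl hP hL h12 hq hf hcu₀ hu₀ hcu₁ hu₁ (Sum.inr (Sum.inr (k, t))) with hb
  have hmeet : meetPt c b l = y.1 := (meetPt_eq c hbl hyb (hP y.1 y.2.1)).symm
  change (0 : ℕ) = (((σ.eZ hl hP h12 hq hf t').1 : Finset P).filter fun q => q ∈ b).card
  rw [← hzeq, σ.card_filter_orb3_on_fixedLine (c := c) hl hbl hz.2.1, hmeet, if_neg (σ.not_mem_orb3_of_fixed y.2.1 hz.2.2)]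

/-- `entry (k,t) (T-point orbit (j,t')) = [β k t j = t']`: a T-line meets `m_j` in one point, in the orbit `β`. -/
theorem entry_eq_tline_tpt (k : Fin 6) (t : Fin 4) (j : Fin 6) (t' : Fin 4) :
    (σ.flagSevenDataOfPlane hl hc hcl hP hL h12 hq hf hcu₀ hu₀ hcu₁ hu₁).entry (Sum.inr (Sum.inr (k, t))) (Sum.inr (Sum.inr (j, t')))
      = ((σ.colOrbit hl hc hcl hP hL h12 hq hf hcu₀ hu₀ hcu₁ hu₁ (Sum.inr (Sum.inr (j, t')))).filter
          fun q => q ∈ σ.lineRep hl hc hcl hP hL h12 hq hf hcu₀ hu₀ hcu₁ hu₁ (Sum.inr (Sum.inr (k, t)))).card := by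
  set m := σ.eFixL6 hl hc hf j with hm
  set y := σ.eFixP6 hl hc hf k with hy
  set eO := σ.eOrbOn hc hcl hP hL h12 hq m with heO
  obtain ⟨w, hw, hweq⟩ := mem_image.1 (eO t').2
  rw [mem_filter] at hw
  obtain ⟨hyb, hbl, hborb⟩ := σ.lineRep_tline_spec hl hc hcl hP hL h12 hq hf hcu₀ hu₀ hcu₁ hu₁ k t
  set b := σ.lineRep hl hc hcl hP hL h12 hq hf hcu₀ hu₀ hcu₁ hu₁ (Sum.inr (Sum.inr (k, t))) with hb
  have hcb : c ∉ b := σ.c_not_mem_tline hcl hP y.2.1 y.2.2 hyb hbl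
  have hbm : b ≠ m.1 := fun e => hcb (e ▸ hL m.1 m.2.1)
  -- unfold the entry: ind (β k t j = t')
  have hβ : (σ.flagSevenDataOfPlane hl hc hcl hP hL h12 hq hf hcu₀ hu₀ hcu₁ hu₁).β k t j = eO.symm
      ⟨σ.betaOrb c m.1 ((σ.eLOrb hl hcl hP hL h12 hq y) t).1, by
          obtain ⟨b₁, hb₁, hb₁eq⟩ := mem_image.1 ((σ.eLOrb hl hcl hP hL h12 hq y) t).2
          rw [mem_filter] at hb₁
          rw [← hb₁eq]
          exact σ.betaOrb_mem hc hcl hP hL hq y.2.1 y.2.2 hb₁.2.1 hb₁.2.2 m.2.1 m.2.2⟩ := rfl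
  change FlagSevenOrbitData.ind ((σ.flagSevenDataOfPlane hl hc hcl hP hL h12 hq hf hcu₀ hu₀ hcu₁ hu₁).β k t j = t')
    = (((eO t').1 : Finset P).filter fun q => q ∈ b).card
  rw [← hweq, σ.card_filter_orb3_on_fixedLine (c := c) m.2.1 hbm hw.2.1]
  -- both conditions say: the point b ∩ m lies in orb3 w
  have hval : σ.betaOrb c m.1 ((σ.eLOrb hl hcl hP hL h12 hq y) t).1 = orb3 σ.onPoints (meetPt c b m.1) := by
    rw [← hborb]; exact σ.betaOrb_eq hc hL hq m.2.1 hcb (self_mem_orb3 _ _)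
  have hiff : (σ.flagSevenDataOfPlane hl hc hcl hP hL h12 hq hf hcu₀ hu₀ hcu₁ hu₁).β k t j = t' ↔ meetPt c b m.1 ∈ orb3 σ.onPoints w := by
    rw [hβ]
    constructor
    · intro h1
      have := congrArg (fun s => (eO s).1) h1
      simp only [Equiv.apply_symm_apply] at this
      rw [hval, ← hweq] at this
      rw [← this]; exact self_mem_orb3 _ _
    · intro h1
      apply eO.injective; rw [Equiv.apply_symm_apply]; apply Subtype.ext
      change σ.betaOrb c m.1 ((σ.eLOrb hl hcl hP hL h12 hq y) t).1 = (eO t').1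
      rw [hval, ← hweq]; exact orb3_eq_of_mem σ.onPoints hq h1
  unfold FlagSevenOrbitData.ind
  by_cases h : meetPt c b m.1 ∈ orb3 σ.onPoints w
  · rw [if_pos h, if_pos (hiff.2 h)]
  · rw [if_neg h, if_neg (fun h' => h (hiff.1 h'))]

/-- `entry (k,t) (triangle (s,i)) = [i ∈ C k t s]`: a T-line carries at most one vertex of each triangle, and one iff the line `x_i·y_k` lies in
the orbit `(k,t)`. -/
theorem entry_eq_tline_tri (k : Fin 6) (t : Fin 4) (s : Fin 2) (i : Fin 12) :
    (σ.flagSevenDataOfPlane hl hc hcl hP hL h12 hq hf hcu₀ hu₀ hcu₁ hu₁).entry (Sum.inr (Sum.inr (k, t))) (Sum.inr (Sum.inl (s, i)))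
      = ((σ.colOrbit hl hc hcl hP hL h12 hq hf hcu₀ hu₀ hcu₁ hu₁ (Sum.inr (Sum.inl (s, i)))).filter
          fun q => q ∈ σ.lineRep hl hc hcl hP hL h12 hq hf hcu₀ hu₀ hcu₁ hu₁ (Sum.inr (Sum.inr (k, t)))).card := by
  set x := σ.eTri7 h12 hcu₀ hu₀ hcu₁ hu₁ s i with hx
  set y := σ.eFixP6 hl hc hf k with hy
  obtain ⟨hyb, hbl, hborb⟩ := σ.lineRep_tline_spec hl hc hcl hP hL h12 hq hf hcu₀ hu₀ hcu₁ hu₁ k t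
  set b := σ.lineRep hl hc hcl hP hL h12 hq hf hcu₀ hu₀ hcu₁ hu₁ (Sum.inr (Sum.inr (k, t))) with hb
  have hxX := σ.exterior_of_triIdx s x hcu₀ hu₀ hcu₁ hu₁ hL
  have hC : (σ.flagSevenDataOfPlane hl hc hcl hP hL h12 hq hf hcu₀ hu₀ hcu₁ hu₁).C k t s
      = univ.filter fun i₀ : Fin 12 => σ.cOrb l y.1 (σ.eTri7 h12 hcu₀ hu₀ hcu₁ hu₁ s i₀).1 = ((σ.eLOrb hl hcl hP hL h12 hq y) t).1 := rfl
  change FlagSevenOrbitData.ind (i ∈ (σ.flagSevenDataOfPlane hl hc hcl hP hL h12 hq hf hcu₀ hu₀ hcu₁ hu₁).C k t s)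
    = ((orb3 σ.onPoints x.1).filter fun q => q ∈ b).card
  rw [hC, mem_filter]
  have hle := σ.tline_orbit_simple hcl hP hL hq y.2.1 y.2.2 hyb hbl x.1
  have hiff : σ.cOrb l y.1 x.1 = ((σ.eLOrb hl hcl hP hL h12 hq y) t).1 ↔ ∃ Q ∈ orb3 σ.onPoints x.1, Q ∈ b := by
    rw [← hborb]; exact σ.cOrb_eq_iff hl hP hq hxX y.2.1 hyb
  unfold FlagSevenOrbitData.ind
  by_cases h : ∃ Q ∈ orb3 σ.onPoints x.1, Q ∈ b
  · rw [if_pos ⟨mem_univ _, hiff.2 h⟩]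
    obtain ⟨Q, hQ, hQb⟩ := h
    have hpos : 0 < ((orb3 σ.onPoints x.1).filter fun q => q ∈ b).card := card_pos.2 ⟨Q, mem_filter.2 ⟨hQ, hQb⟩⟩
    omega
  · rw [if_neg (fun h' => h (hiff.1 h'.2)), eq_comm, card_eq_zero, filter_eq_empty_iff]
    intro Q hQ hQb
    exact h ⟨Q, hQ, hQb⟩

end Data

end Flag

end Collineation

end Summit.Ventures.DiscreteObjects.PP12
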